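import Literature.NumberTheory.Automorphic.IrreducibleClassesBoxChar
import Literature.NumberTheory.Automorphic.UnitaryGroupPrincipalSeriesH
import HarnessLib

/-!
# LATTICE REDUCTION for the principal series of `H_v = U(Φ₂)_v × U(Φ₁)_v`:
# `Subrepresentation (cmPrincipalSeriesH L v χ₂ χ₁) ≃o Subrepresentation (cmPrincipalSeries L 2 v χ₂)` and the transport of constituents ∕ labels

Topic `NumberTheory/Automorphic`; namespace `Literature.NumberTheory.Automorphic.UnitaryGroup`.  The CM instance of ★ `Automorphic/IrreducibleClassesBoxChar`
(`π ⊠ χ`, `subrepresentationTwistCompFstOrderIso`, constituent transport), fully proved; one definition WITH BODY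
(`subrepresentationCMPrincipalSeriesHOrderIso`); no named fact, no `sorry`, no instance, no notation.  Cell `pub/hodgecm-mathlib`, crux H413, F0P3b desk
brief H0 «LATTICE REDUCTION» of the (N-H-ii) road (line «CMCharIdentityTest», stub `stub_hPrincipalSeriesJH`, ED. 10).

★ `UnitaryGroup.cmPrincipalSeriesH L v χ₂ χ₁` (`Automorphic/UnitaryGroupPrincipalSeriesH`, typer D2) IS, by definition,
`i(χ₂) ⊠ χ₁ = Representation.twist ((cmPrincipalSeries L 2 v χ₂).comp pr₁) (χ₁.comp pr₂)` (`cmPrincipalSeriesH_eq_twist_comp_fst`, `rfl`): the compact factor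
`U(Φ₁)_v` acts by the SCALAR `χ₁`.  Hence (all by rewriting with that equation into the generic ★ results):
* **`subrepresentationCMPrincipalSeriesHOrderIso L v χ₂ χ₁ : Subrepresentation (cmPrincipalSeriesH L v χ₂ χ₁) ≃o Subrepresentation (cmPrincipalSeries L 2 v χ₂)`**,
  the identity on underlying subspaces (`…_apply_toSubmodule`, `…_symm_apply_toSubmodule`, `rfl`) — the `H_v`-stable subspaces of `i_H(χ₂ ⊠ χ₁)` are the
  `U(Φ₂)_v`-stable subspaces of `i(χ₂)`;
* `isConstituentOf_cmPrincipalSeriesH_iff` (`ker χ₁` open): the constituents of `i_H(χ₂ ⊠ χ₁)` are exactly the boxes `c ⊠ χ₁ = IrrClass.boxChar χ₁ hχ₁ c` of the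
  constituents `c` of `i(χ₂)`; `boxChar_isConstituentOf_cmPrincipalSeriesH_iff`;
* **`hLengthTwoLabels_boxChar`**: if the constituents of `i(χ₂)` on `U(Φ₂)_v` are exactly `{π₁, πSt}`, `πSt ≠ π₁`, then ★
  `HLengthTwoLabels L v χ₂ χ₁ (π₁ ⊠ χ₁) (πSt ⊠ χ₁)`; with `π₁ = ⟦ℂ_{ξ₂}⟧` one-dimensional, `π₁ ⊠ χ₁ = ⟦ℂ_{ξ_v}⟧` is ★ `IrrClass.boxChar_mk_ofChar`
  (`ξ_v(g, u) = ξ₂(g) χ₁(u)`) — the shape of `stub_hPrincipalSeriesJH`'s `π₁ := IrrClass.mk (SmoothIrrep.ofChar (ξ.xiLocalChar v) hker)`;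
* the converse **`HLengthTwoLabels.exists_eq_boxChar`**: `H_v`-labels come from unique `U(Φ₂)_v`-labels.
So the (N-H-ii) item «`JH(i_H(χ_H)) = {ξ_v, St_H(ξ_v)}`» ([Rogawski1990, §12.1 case (1) for `U(2) × U(1)`]) is REDUCED to the same statement for
`i(χH₂)` on `U(Φ₂)_v ≅ U(1,1)` (road H1–H5 of the F0P2-p06 census).  HONEST LABEL: HC_CM is proved only modulo the 2 remaining named inputs (hLiu418, h413)
until rung 0 closes; this file is plumbing and discharges none of them.

## References
[Rogawski1990] J. D. Rogawski, *Automorphic Representations of Unitary Groups in Three Variables*, Ann. of Math. Stud. 123 (1990), §12.1 pp. 171–172,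
§12.7 Cor. 12.7.4 (proof) p. 188 · [BushnellHenniart2006] §1.1–§2, §9.1.
-/

set_option autoImplicit false

noncomputable section

open NumberField IsDedekindDomain

namespace Literature.NumberTheory.Automorphic

universe u

/-! ## The CM instance: `i_H(χ₂ ⊠ χ₁) = i(χ₂) ⊠ χ₁` on `H_v = U(Φ₂)_v × U(Φ₁)_v` -/

namespace UnitaryGroup

variable (L : Type) [Field L] [NumberField L] [IsCMField L] (v : HeightOneSpectrum (𝓞 ↥(maximalRealSubfield L)))
  (χ₂ : ↥(torusU (conjLocal L (IsCMField.complexConj L) v) (cmLocalForm L 2 v)) →* ℂˣ)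
  (χ₁ : ((cmDatum L 1 (Matrix.of fun i j : Fin 1 => if i.val + j.val + 1 = 1 then (1 : L) else 0)).Local v) →* ℂˣ)

/-- `i_H(χ₂ ⊠ χ₁)` IS `i(χ₂) ⊠ χ₁ = (cmPrincipalSeries L 2 v χ₂ ∘ pr₁) ⊗ (χ₁ ∘ pr₂)` (the body of ★ `cmPrincipalSeriesH`, `rfl`); the §1–§3 results are
moved onto `cmPrincipalSeriesH` by rewriting with this equation. [cite: Rogawski1990, §12.1 p. 171] -/
theorem cmPrincipalSeriesH_eq_twist_comp_fst :
    cmPrincipalSeriesH L v χ₂ χ₁ =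
      haveI := locallyCompactSpace_cmBorelU L 2 v
      Representation.twist ((cmPrincipalSeries L 2 v χ₂).comp (MonoidHom.fst ((cmDatum L 2 (Matrix.of fun i j : Fin 2 => if i.val + j.val + 1 = 2 then (1 : L) else 0)).Local v) ((cmDatum L 1 (Matrix.of fun i j : Fin 1 => if i.val + j.val + 1 = 1 then (1 : L) else 0)).Local v)))
        (χ₁.comp (MonoidHom.snd ((cmDatum L 2 (Matrix.of fun i j : Fin 2 => if i.val + j.val + 1 = 2 then (1 : L) else 0)).Local v) ((cmDatum L 1 (Matrix.of fun i j : Fin 1 => if i.val + j.val + 1 = 1 then (1 : L) else 0)).Local v))) :=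
  rfl

/-- **LATTICE REDUCTION for `i_H(χ₂ ⊠ χ₁)`**:
`subrepresentationCMPrincipalSeriesHOrderIso L v χ₂ χ₁ : Subrepresentation (cmPrincipalSeriesH L v χ₂ χ₁) ≃o Subrepresentation (cmPrincipalSeries L 2 v χ₂)`,
the identity on underlying subspaces — the `H_v`-stable subspaces of `i_H(χ)` are the `U(Φ₂)_v`-stable subspaces of `i(χ₂)` (`U(Φ₁)_v` acts by
the scalar `χ₁`).  (The type is the one Lean infers from ★ `subrepresentationTwistCompFstOrderIso` at `G := U(Φ₂)_v` in its ★ `cmDatum … .Local v`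
spelling, the spelling of ★ `cmPrincipalSeriesH`'s carrier; the two `toSubmodule` computation rules below are `rfl`.) [cite: Rogawski1990, §12.1 p. 171] -/
def subrepresentationCMPrincipalSeriesHOrderIso :=
  haveI := locallyCompactSpace_cmBorelU L 2 v
  (subrepresentationTwistCompFstOrderIso (G := ((cmDatum L 2 (Matrix.of fun i j : Fin 2 => if i.val + j.val + 1 = 2 then (1 : L) else 0)).Local v))
      (G₁ := ((cmDatum L 1 (Matrix.of fun i j : Fin 1 => if i.val + j.val + 1 = 1 then (1 : L) else 0)).Local v)) (cmPrincipalSeries L 2 v χ₂) χ₁ :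
    Subrepresentation (cmPrincipalSeriesH L v χ₂ χ₁) ≃o _)

/-- The reduction does not move the subspace. [cite: Rogawski1990, §12.1 p. 171] -/
theorem subrepresentationCMPrincipalSeriesHOrderIso_apply_toSubmodule (N' : Subrepresentation (cmPrincipalSeriesH L v χ₂ χ₁)) :
    (subrepresentationCMPrincipalSeriesHOrderIso L v χ₂ χ₁ N').toSubmodule = N'.toSubmodule := rfl

/-- Nor does its inverse. [cite: Rogawski1990, §12.1 p. 171] -/
theorem subrepresentationCMPrincipalSeriesHOrderIso_symm_apply_toSubmodule
    (N : Subrepresentation (haveI := locallyCompactSpace_cmBorelU L 2 v; cmPrincipalSeries L 2 v χ₂)) :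
    ((subrepresentationCMPrincipalSeriesHOrderIso L v χ₂ χ₁).symm N).toSubmodule = N.toSubmodule := rfl

variable (hχ₁ : IsOpen ((χ₁.ker : Subgroup ((cmDatum L 1 (Matrix.of fun i j : Fin 1 => if i.val + j.val + 1 = 1 then (1 : L) else 0)).Local v)) :
  Set ((cmDatum L 1 (Matrix.of fun i j : Fin 1 => if i.val + j.val + 1 = 1 then (1 : L) else 0)).Local v)))

set_option maxHeartbeats 400000 in
/-- **The constituents of `i_H(χ₂ ⊠ χ₁)` are exactly the boxes `c ⊠ χ₁` of the constituents `c` of `i(χ₂)`** (`ker χ₁` open).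
[cite: Rogawski1990, §12.1 pp. 171–172] -/
theorem isConstituentOf_cmPrincipalSeriesH_iff (c' : IrrClass (((cmDatum L 2 (Matrix.of fun i j : Fin 2 => if i.val + j.val + 1 = 2 then (1 : L) else 0)).Local v) × ((cmDatum L 1 (Matrix.of fun i j : Fin 1 => if i.val + j.val + 1 = 1 then (1 : L) else 0)).Local v))) :
    c'.IsConstituentOf (cmPrincipalSeriesH L v χ₂ χ₁) ↔
      ∃ c : IrrClass ((cmDatum L 2 (Matrix.of fun i j : Fin 2 => if i.val + j.val + 1 = 2 then (1 : L) else 0)).Local v),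
        c' = IrrClass.boxChar χ₁ hχ₁ c ∧ c.IsConstituentOf (haveI := locallyCompactSpace_cmBorelU L 2 v; cmPrincipalSeries L 2 v χ₂) := by
  rw [cmPrincipalSeriesH_eq_twist_comp_fst]
  exact IrrClass.isConstituentOf_twist_comp_fst_iff (G := ((cmDatum L 2 (Matrix.of fun i j : Fin 2 => if i.val + j.val + 1 = 2 then (1 : L) else 0)).Local v))
    (G₁ := ((cmDatum L 1 (Matrix.of fun i j : Fin 1 => if i.val + j.val + 1 = 1 then (1 : L) else 0)).Local v)) χ₁ hχ₁ _ c'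

/-- `c ⊠ χ₁` is a constituent of `i_H(χ₂ ⊠ χ₁)` iff `c` is a constituent of `i(χ₂)`. [cite: Rogawski1990, §12.1 pp. 171–172] -/
theorem boxChar_isConstituentOf_cmPrincipalSeriesH_iff (c : IrrClass ((cmDatum L 2 (Matrix.of fun i j : Fin 2 => if i.val + j.val + 1 = 2 then (1 : L) else 0)).Local v)) :
    (IrrClass.boxChar χ₁ hχ₁ c).IsConstituentOf (cmPrincipalSeriesH L v χ₂ χ₁) ↔
      c.IsConstituentOf (haveI := locallyCompactSpace_cmBorelU L 2 v; cmPrincipalSeries L 2 v χ₂) := by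
  rw [cmPrincipalSeriesH_eq_twist_comp_fst]
  exact IrrClass.boxChar_isConstituentOf_iff (G := ((cmDatum L 2 (Matrix.of fun i j : Fin 2 => if i.val + j.val + 1 = 2 then (1 : L) else 0)).Local v))
    (G₁ := ((cmDatum L 1 (Matrix.of fun i j : Fin 1 => if i.val + j.val + 1 = 1 then (1 : L) else 0)).Local v)) χ₁ hχ₁ _ c

/-- **H0 (⇒): labels of `i(χ₂)` on `U(Φ₂)_v` give the `H_v`-labels** — if the constituents of `i(χ₂) = cmPrincipalSeries L 2 v χ₂` are exactly
`{π₁, πSt}`, `πSt ≠ π₁`, then `HLengthTwoLabels L v χ₂ χ₁ (π₁ ⊠ χ₁) (πSt ⊠ χ₁)`: the constituents of `i_H(χ₂ ⊠ χ₁)` are exactly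
`{π₁ ⊠ χ₁, πSt ⊠ χ₁}`, two distinct classes.  With `π₁ = ⟦ℂ_{ξ₂}⟧` one-dimensional, `π₁ ⊠ χ₁ = ⟦ℂ_{ξ_v}⟧` by `IrrClass.boxChar_mk_ofChar`.
[cite: Rogawski1990, §12.1 pp. 171–172; §12.7 Cor. 12.7.4 (proof) p. 188] -/
theorem hLengthTwoLabels_boxChar {π₁ πSt : IrrClass ((cmDatum L 2 (Matrix.of fun i j : Fin 2 => if i.val + j.val + 1 = 2 then (1 : L) else 0)).Local v)} (hne : πSt ≠ π₁)
    (h : ∀ c : IrrClass ((cmDatum L 2 (Matrix.of fun i j : Fin 2 => if i.val + j.val + 1 = 2 then (1 : L) else 0)).Local v),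
      c.IsConstituentOf (haveI := locallyCompactSpace_cmBorelU L 2 v; cmPrincipalSeries L 2 v χ₂) ↔ (c = π₁ ∨ c = πSt)) :
    HLengthTwoLabels L v χ₂ χ₁ (IrrClass.boxChar χ₁ hχ₁ π₁) (IrrClass.boxChar χ₁ hχ₁ πSt) := by
  rw [hLengthTwoLabels_iff, cmPrincipalSeriesH_eq_twist_comp_fst]
  exact IrrClass.constituents_pair_boxChar (G := ((cmDatum L 2 (Matrix.of fun i j : Fin 2 => if i.val + j.val + 1 = 2 then (1 : L) else 0)).Local v))
    (G₁ := ((cmDatum L 1 (Matrix.of fun i j : Fin 1 => if i.val + j.val + 1 = 1 then (1 : L) else 0)).Local v)) χ₁ hχ₁ hne h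

variable {L v χ₂ χ₁} in
/-- **H0 (⇐): the `H_v`-labels come from `U(Φ₂)_v`** — under `HLengthTwoLabels L v χ₂ χ₁ π₁′ πSt′` (`ker χ₁` open) there are unique classes
`π₁ ≠ πSt` of `U(Φ₂)_v`, exactly the constituents of `i(χ₂)`, with `π₁′ = π₁ ⊠ χ₁` and `πSt′ = πSt ⊠ χ₁`. [cite: Rogawski1990, §12.1 pp. 171–172] -/
theorem HLengthTwoLabels.exists_eq_boxChar {π₁' πSt' : IrrClass (((cmDatum L 2 (Matrix.of fun i j : Fin 2 => if i.val + j.val + 1 = 2 then (1 : L) else 0)).Local v) × ((cmDatum L 1 (Matrix.of fun i j : Fin 1 => if i.val + j.val + 1 = 1 then (1 : L) else 0)).Local v))}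
    (hlab : HLengthTwoLabels L v χ₂ χ₁ π₁' πSt') :
    ∃ π₁ πSt : IrrClass ((cmDatum L 2 (Matrix.of fun i j : Fin 2 => if i.val + j.val + 1 = 2 then (1 : L) else 0)).Local v),
      π₁' = IrrClass.boxChar χ₁ hχ₁ π₁ ∧ πSt' = IrrClass.boxChar χ₁ hχ₁ πSt ∧ πSt ≠ π₁ ∧
        ∀ c : IrrClass ((cmDatum L 2 (Matrix.of fun i j : Fin 2 => if i.val + j.val + 1 = 2 then (1 : L) else 0)).Local v),
          c.IsConstituentOf (haveI := locallyCompactSpace_cmBorelU L 2 v; cmPrincipalSeries L 2 v χ₂) ↔ (c = π₁ ∨ c = πSt) := by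
  rw [hLengthTwoLabels_iff, cmPrincipalSeriesH_eq_twist_comp_fst] at hlab
  exact IrrClass.exists_constituents_pair_of_boxChar (G := ((cmDatum L 2 (Matrix.of fun i j : Fin 2 => if i.val + j.val + 1 = 2 then (1 : L) else 0)).Local v))
    (G₁ := ((cmDatum L 1 (Matrix.of fun i j : Fin 1 => if i.val + j.val + 1 = 1 then (1 : L) else 0)).Local v)) χ₁ hχ₁ hlab.1 hlab.2

end UnitaryGroup

end Literature.NumberTheory.Automorphic

end
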